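import Mathlib.Analysis.Complex.Basic
import Mathlib.RingTheory.PowerSeries.Derivative
import Mathlib.RingTheory.MvPolynomial.Homogeneous
import Mathlib.RingTheory.Algebraic.Basic
import Mathlib.FieldTheory.Minpoly.Field
import Mathlib.NumberTheory.NumberField.Basic
import Mathlib.NumberTheory.NumberField.Completion.FinitePlace
import Mathlib.NumberTheory.Height.NumberField
import HarnessLib

/-!
# `G`-functions (Siegel, André) and André's "Hasse principle" for the values of `G`-functions

`Literature/NumberTheory/Transcendental/GFunctionHassePrinciple.lean` — vocabulary of Siegel's
`G`-series / `G`-functions and the NAMED FACT "Hasse principle for the values of `G`-functions"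
(André 1989, *G-functions and Geometry*, Introduction Thm. E and Ch. VII Thm. 5.2; restated
verbatim with a proof of the deduction E ⇐ VII 5.2 in Daw–Orr 2025, Thms. 2.4–2.5; quoted as
Papas 2022, Thm. 2), requested by route `LiftingCriteria` of `KontsevichZagierPeriods`
(crux `VertexLocalLift`, item `stmt-KontsevichZagierPeriods-3573`): at `ξ = 1/b`, `K = ℚ`,
degree `δ = 1`, the only place `v` of `ℚ` with `|ξ|_v < 1` is `∞`, so a single real linear
relation among `G`-values is GLOBAL, and the theorem forces it to be TRIVIAL (the specialisation
of a functional relation) as soon as `log b = h(1/b)` exceeds a constant.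

## What the sources print (verified on the page)

* [Rivoal2024] Définition 5.22 (Siegel), p. 242: "Une `G`-fonction est une série entière
  `F(z) = ∑ aₙ zⁿ ∈ ℚ̄[[z]]` telle que (i) `F(z)` est solution d'une équation différentielle
  linéaire non nulle à coefficients dans `ℚ̄(z)`. (ii) Il existe une constante `C > 0` telle que
  pour tout `σ ∈ Gal(ℚ̄/ℚ)` et tout `n ⩾ 0`, on ait `|σ(aₙ)| ⩽ C^{n+1}`. (iii) Il existe une suite
  d'entiers `(Dₙ)` et une constante `D > 0` telles que pour `0 ⩽ m ⩽ n`, `Dₙ a_m ∈ O_ℚ̄` et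
  `1 ⩽ |Dₙ| ⩽ D^{n+1}`"; p. 243: (i) implies that the `aₙ` lie in a number field `K`, and in
  (ii) it suffices to take `σ ∈ Gal(K/ℚ)`.
* [DawOrr2025] §2.3, Definition ([Andre1989] p. 1): a `G`-function is a power series whose
  coefficients belong to a number field `K`, with geometric archimedean growth at every
  archimedean absolute value of `K`, a sequence of positive integers `(dₙ)` growing at most
  geometrically with `dₙ a_m` an algebraic integer for `m ≤ n`, and a linear homogeneous
  differential equation with coefficients in `K(X)`.
  Definition: `Q̃ ∈ ℚ̄[X][Y₁,…,Yₙ]` homogeneous is a FUNCTIONAL RELATION between `y₁,…,yₙ` if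
  `Q̃(X)(y₁(X),…,yₙ(X)) = 0` in `ℚ̄[[X]]`.
  Definition: for `ξ ∈ ℚ̄`, `Q ∈ ℚ̄[Y₁,…,Yₙ]` homogeneous and `K` a number field containing `ξ`
  and the coefficients of the `yᵢ` and of `Q`: (1) `Q` is an `ι`-ADIC RELATION between the
  evaluations at `ξ` (for an embedding `ι` of `K` into `ℂ` or `ℂ_p`) if
  `|ξ^ι| < min{1, R(y₁^ι),…,R(yₙ^ι)}` (radii of convergence) and `Q^ι(y₁^ι(ξ^ι),…,yₙ^ι(ξ^ι)) = 0`;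
  (2) `Q` is a GLOBAL RELATION if it is an `ι`-adic relation for every embedding `ι` of `K`
  satisfying `|ξ^ι| < min{1, R(yᵢ^ι)}` ("Of course, the set of such embeddings may be empty");
  (3) `Q` is a TRIVIAL RELATION at `ξ` if it is the specialisation at `X = ξ` of a functional
  relation `Q̃`, homogeneous of the same degree as `Q`. (Same definitions: [Papas2022] §1.1,
  with places `v` of `K`, `i_v : K → K_v`, and `R_v(Y) = min R_v(y_j)`; [Andre1989] VII §5.)
* [DawOrr2025] Thm. 2.4 = [Andre1989, VII Thm. 5.2]: `G`-functions `y₁,…,yₙ ∈ ℚ̄[[X]]` with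
  `dyᵢ/dX = ∑ⱼ aᵢⱼ yⱼ`, `aᵢⱼ ∈ ℚ̄(X)` ⇒ there are constants `c₁, c₂` depending only on the `yᵢ`
  such that for all `ξ ∈ ℚ̄ ∖ {0}` and `δ ∈ ℤ_{>0}`, if `ξ` is not a singularity of the system and
  there is a non-trivial global relation of degree `δ` between the evaluations at `ξ`, then
  `h(ξ) ≤ c₁ δ^{c₂}` (Weil height). [Papas2022] Thm. 2 prints the explicit
  `h(Ш_δ(Y)) ≤ c₁(Y) δ^{3(m−1)} (log δ + 1)` (and `c₂(Y) δ^m (log δ + 1)` for STRONGLY non-trivial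
  relations), "In particular any subset of `Ш_δ(Y)` with bounded degree over `ℚ` is finite."
* [DawOrr2025] Thm. 2.5 = [Andre1989, Introduction, Thm. E], PROVED there from Thm. 2.4
  (Lemma 2.6, a Gröbner-basis argument absorbing the derivatives and the finitely many
  exceptional `ξ` into the constants): "Let `y₁,…,yₙ ∈ ℚ̄[[X]]` be `G`-functions. There exist
  constants `c₃, c₄` depending only on `y₁,…,yₙ`, such that, for all `ξ ∈ ℚ̄ ∖ {0}` and all
  `δ ∈ ℤ_{>0}`, if there exists a non-trivial global relation of degree `δ` between the
  evaluations of `y₁,…,yₙ` at `ξ`, then `h(ξ) ≤ c₃ δ^{c₄}`." Remark (ibid.): nothing in the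
  proof, constants included, depends on the number field `K`; the case where no embedding is
  small is covered by [Papas2022] (proof of Thm. 1, Case 1: then `h(ξ) ≤ ρ(Y) < ∞`).

## Lean rendering

* `gSeries a z = ∑' aₙ zⁿ` and `IsGSeries (a : ℕ → ℂ)` = Définition 5.22 on complex algebraic
  coefficient sequences, shaped exactly like the `E`-side
  `Literature.Barriers.Schanuel.IsStrictEFunction`: `σ(aₙ)` = the complex roots of
  `minpoly ℚ aₙ`, `O_ℚ̄` = `IsIntegral ℤ`, and (i) as a non-zero linear ODE with coefficients in
  `ℚ̄[z]` (denominators cleared) imposed on the FORMAL power series `PowerSeries.mk a` with the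
  formal derivative `PowerSeries.derivative` (a `G`-series has finite radius, so the identity is
  stated in `ℂ⟦X⟧`, where it is equivalent to the analytic one on the disc of convergence).
* `IsGFunction (y : K⟦X⟧)` for a number field `K` = the same three conditions for a series with
  coefficients in `K` ([DawOrr2025] Def.; Rivoal p. 243): archimedean growth over all
  embeddings `σ : K →+* ℂ`, denominators `dₙ ∈ ℕ`, `1 ≤ dₙ ≤ D^{n+1}`, `dₙ a_m ∈ 𝓞 K`
  (`IsIntegral ℤ`), holonomic over `K[X]`. This is the level at which PLACES make sense.
* Relations at `ξ ∈ K` among `y : Fin n → K⟦X⟧` (namespace `GFunction`): for a ring hom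
  `ι : K →+* F` into a normed field (`σ : K →+* ℂ` for the infinite places,
  `NumberField.FinitePlace.embedding v : K →+* v.adicCompletion K` for the finite places
  `v : HeightOneSpectrum (𝓞 K)` — Mathlib's `v`-adic completion is a normed field):
  `InsideDisc` renders `|x| < R(∑ aₙXⁿ)` as "some `r > ‖x‖` has `∑ ‖aₙ‖ rⁿ < ∞`" (equivalent to
  `‖x‖ <` the Cauchy–Hadamard radius); `IsSmallAt ι y ξ` is `|ξ|_ι < min{1, R_ι(y_j)}`;
  `adicValue ι y ξ = ∑' ι(aₖ) ι(ξ)ᵏ`; `IsAdicRelationAt` / `IsGlobalRelationAt` /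
  `IsTrivialRelationAt` are Definitions (1)/(2)/(3), triviality being witnessed by
  `Q̃ : MvPolynomial (Fin n) K[X]` homogeneous of degree `δ` with `aeval y Q̃ = 0` in `K⟦X⟧` and
  `map (evalRingHom ξ) Q̃ = Q`. Witnesses over `K[X]` rather than `ℚ̄[X]`: for `y, ξ, Q` over `K`
  the two are equivalent (the conditions on `Q̃` of bounded `X`-degree form a linear system with
  coefficients in `K`, solvable over an extension iff solvable over `K`).
* NAMED FACT `andre_hassePrinciple_gValues` = [DawOrr2025] Thm. 2.5 (= [Andre1989] Thm. E,
  deduced from VII Thm. 5.2): for `G`-functions `y₁,…,yₙ` over a number field `K` there are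
  `c₁, c₂ ≥ 0` such that for every finite extension `L/K` (any number field `L` with
  `[Algebra K L]`), every `ξ ∈ L ∖ {0}`, every `δ > 0` and every homogeneous
  `Q ∈ L[Y₁,…,Yₙ]` of degree `δ` which is a global but not a trivial relation between the
  evaluations at `ξ` of the base-changed `yᵢ`, `logHeight₁ ξ ≤ [L:ℚ] · c₁ δ^{c₂}` — Mathlib's
  `Height.logHeight₁` on a number field `L` is the RELATIVE height `[L:ℚ] · h(ξ)`
  (`NumberField.instAdmissibleAbsValues`; e.g. `logHeight₁ (n : L) = [L:ℚ] log n`), so this is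
  the printed `h(ξ) ≤ c₁ δ^{c₂}` with constants uniform in `L`, as printed. The exponent is left
  unspecified as in [DawOrr2025] ([Papas2022] prints `δ^{3(m−1)}(log δ+1)` in Thm. 2 but uses
  `δ^{3μh−1}` in its proof, so the explicit form is not hard-coded here); the VII 5.2 form (with
  a differential system and `ξ` non-singular) has MORE hypotheses and the same conclusion, so it
  is implied by this one.
* PROVED API: the geometric series is a `G`-series / `G`-function (`isGSeries_one`,
  `isGFunction_mk_one` — Siegel: "zu ihnen gehört trivialerweise die geometrische Reihe"), the
  constant `1` is a `G`-function (`isGFunction_one`, the `y₀ = 1` of inhomogeneous relations),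
  and the zero polynomial is a trivial and a global relation.

## Not here (deliberately)

The size `σ(Y)` and global radius `ρ(Y)` of [Andre1989] Ch. I (by [DawOrr2025] Rem. after
Thm. 2.4, `σ(Y) < ∞` ⟺ `G`-functions, given the system); apparent singularities; the strongly
non-trivial variant `h(Ш′_δ) ≤ c₂ δ^m (log δ + 1)`; Bombieri's Thm. 4 [Bombieri1981] and
Chudnovsky's single-place theorem; the fact that dilation integrals `∫_{[0,1]ⁿ} p(ϖz)/q(ϖz) dz`
are `G`-functions with a common Fuchsian system ([Lipshitz1989], [Andre1989] Ch. V–VI) — a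
separate request of the same route; no discharge of the named fact is attempted.
-/

noncomputable section

open Polynomial PowerSeries

namespace Literature.NumberTheory.Transcendental

/-! ### 1. `G`-series with complex algebraic coefficients (Siegel; Rivoal Déf. 5.22) -/

/-- The ordinary generating series `y(z) = ∑ₙ aₙ zⁿ` of a coefficient sequence `a`, as a complex
`tsum` (junk value `0` where the series diverges; meaningful on the disc of convergence).
[cite: Rivoal2024, Définition 5.22] -/
def gSeries (a : ℕ → ℂ) (z : ℂ) : ℂ :=
  ∑' n : ℕ, a n * z ^ n

/-- **`G`-series / `G`-function (Siegel 1929; Rivoal Déf. 5.22; André Ch. I)** as a predicate on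
the complex coefficient sequence `aₙ` of `y = ∑ aₙ zⁿ ∈ ℚ̄[[z]]`: `aₙ ∈ ℚ̄`; (i) `y` satisfies a
non-zero linear differential equation with coefficients in `ℚ̄[z]` — imposed on the formal power
series `PowerSeries.mk a` with the formal derivative, `P ≠ 0`; (ii) all conjugates of `aₙ` (the
complex roots of `minpoly ℚ aₙ`) have absolute value `≤ C^{n+1}`; (iii) common denominators
`1 ≤ Dₙ ≤ D^{n+1}` with `Dₙ a_m` an algebraic integer for `m ≤ n`. The `E`-side twin is
`Literature.Barriers.Schanuel.IsStrictEFunction` (same (ii), (iii); ODE on `∑ aₙzⁿ/n!`).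
[cite: Rivoal2024, Définition 5.22] -/
def IsGSeries (a : ℕ → ℂ) : Prop :=
  (∀ n, IsAlgebraic ℚ (a n)) ∧
  (∃ (m : ℕ) (P : Fin (m + 1) → Polynomial ℂ), P ≠ 0 ∧ (∀ j k, IsAlgebraic ℚ ((P j).coeff k)) ∧
    ∑ j : Fin (m + 1), (P j : PowerSeries ℂ) * (⇑(PowerSeries.derivative ℂ))^[j] (PowerSeries.mk a)
      = 0) ∧
  (∃ C : ℝ, 0 < C ∧ ∀ n, ∀ b ∈ (minpoly ℚ (a n)).rootSet ℂ, ‖b‖ ≤ C ^ (n + 1)) ∧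
  (∃ (D : ℕ → ℤ) (D₀ : ℝ), 0 < D₀ ∧ ∀ n, 1 ≤ D n ∧ (D n : ℝ) ≤ D₀ ^ (n + 1) ∧
    ∀ m ≤ n, IsIntegral ℤ ((D n : ℂ) * a m))

/-! ### 2. `G`-functions with coefficients in a number field `K` -/

section NumberFieldLevel

variable {K : Type*} [Field K]

/-- **`G`-function with coefficients in the number field `K`** ([Andre1989] p. 1 as printed in
[DawOrr2025] §2.3; Rivoal Déf. 5.22 with p. 243): `y = ∑ aₙ Xⁿ ∈ K⟦X⟧` such that (i) `y`
satisfies a non-zero linear differential equation with coefficients in `K[X]` (formal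
derivative; `P ≠ 0`); (ii) there is `C > 0` with `|σ(aₙ)| ≤ C^{n+1}` for every complex embedding
`σ : K →+* ℂ` and every `n` (geometric growth at every archimedean absolute value); (iii) there
are positive integers `dₙ ≤ D^{n+1}` (geometric growth) with `dₙ a_m ∈ 𝓞 K` for all `m ≤ n`.
Intended for `[NumberField K]`. [cite: DawOrr2025, Definition 2.3 (G-function)] -/
def IsGFunction (y : PowerSeries K) : Prop :=
  (∃ (m : ℕ) (P : Fin (m + 1) → Polynomial K), P ≠ 0 ∧
    ∑ j : Fin (m + 1), (P j : PowerSeries K) * (⇑(PowerSeries.derivative K))^[j] y = 0) ∧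
  (∃ C : ℝ, 0 < C ∧ ∀ (σ : K →+* ℂ) (n : ℕ), ‖σ (coeff n y)‖ ≤ C ^ (n + 1)) ∧
  (∃ (d : ℕ → ℕ) (D : ℝ), 0 < D ∧ ∀ n, 1 ≤ d n ∧ (d n : ℝ) ≤ D ^ (n + 1) ∧
    ∀ m ≤ n, IsIntegral ℤ ((d n : K) * coeff m y))

/-! ### 3. `ι`-adic, global and trivial relations among the values at `ξ` -/

namespace GFunction

variable {F : Type*} [NormedField F]

/-- `x` lies STRICTLY INSIDE the disc of convergence of `∑ aₙ Xⁿ` in the normed field `F`: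
`‖x‖ < R`, `R⁻¹ = limsup ‖aₙ‖^{1/n}` (Cauchy–Hadamard), rendered equivalently as: some real
`r > ‖x‖` has `∑ ‖aₙ‖ rⁿ < ∞`. [folklore] -/
def InsideDisc (a : ℕ → F) (x : F) : Prop :=
  ∃ r : ℝ, ‖x‖ < r ∧ Summable fun n => ‖a n‖ * r ^ n

/-- The `ι`-adic value `y^ι(ξ^ι) = ∑ₖ ι(aₖ) ι(ξ)ᵏ ∈ F` of `y = ∑ aₖ Xᵏ ∈ K⟦X⟧` at `ξ ∈ K` along
`ι : K →+* F` (a `tsum`; meaningful when `ι ξ` is inside the disc of convergence).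
[cite: DawOrr2025, §2.1 and Definition 2.3] -/
def adicValue (ι : K →+* F) (y : PowerSeries K) (ξ : K) : F :=
  ∑' k : ℕ, ι (coeff k y) * ι ξ ^ k

/-- The smallness condition `|ξ^ι| < min{1, R(y₁^ι), …, R(yₙ^ι)}` at the "place" `ι : K →+* F`.
[cite: DawOrr2025, Definition 2.3 (1)] -/
def IsSmallAt (ι : K →+* F) {n : ℕ} (y : Fin n → PowerSeries K) (ξ : K) : Prop :=
  ‖ι ξ‖ < 1 ∧ ∀ j, InsideDisc (fun k => ι (coeff k (y j))) (ι ξ)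

/-- The `ι`-adic evaluation `Q^ι(y₁^ι(ξ^ι), …, yₙ^ι(ξ^ι)) ∈ F` of `Q ∈ K[Y₁,…,Yₙ]`.
[cite: DawOrr2025, Definition 2.3 (1)] -/
def adicEval (ι : K →+* F) {n : ℕ} (y : Fin n → PowerSeries K) (ξ : K)
    (Q : MvPolynomial (Fin n) K) : F :=
  MvPolynomial.eval (fun j => adicValue ι (y j) ξ) (MvPolynomial.map ι Q)

/-- `Q` is an **`ι`-adic relation** between the evaluations at `ξ` of `y₁, …, yₙ`:
`|ξ^ι| < min{1, R(yⱼ^ι)}` and `Q^ι(y₁^ι(ξ^ι), …, yₙ^ι(ξ^ι)) = 0` (`ι` an embedding of `K` into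
`ℂ`, or into the completion at a finite place). [cite: DawOrr2025, Definition 2.3 (1)] -/
def IsAdicRelationAt (ι : K →+* F) {n : ℕ} (y : Fin n → PowerSeries K) (ξ : K)
    (Q : MvPolynomial (Fin n) K) : Prop :=
  IsSmallAt ι y ξ ∧ adicEval ι y ξ Q = 0

variable [NumberField K]

open IsDedekindDomain NumberField in
/-- `Q` is a **global relation** between the evaluations at `ξ` of `y₁, …, yₙ`: it is an
`ι`-adic relation for EVERY complex embedding `σ : K →+* ℂ` and EVERY finite place
`v : HeightOneSpectrum (𝓞 K)` (`ι = FinitePlace.embedding v : K →+* v.adicCompletion K`) at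
which `|ξ|_ι < min{1, R_ι(yⱼ)}`; the set of such places may be empty (then every `Q` is global).
[cite: DawOrr2025, Definition 2.3 (2)] -/
def IsGlobalRelationAt {n : ℕ} (y : Fin n → PowerSeries K) (ξ : K)
    (Q : MvPolynomial (Fin n) K) : Prop :=
  (∀ σ : K →+* ℂ, IsSmallAt σ y ξ → IsAdicRelationAt σ y ξ Q) ∧
  (∀ v : HeightOneSpectrum (𝓞 K), IsSmallAt (FinitePlace.embedding v) y ξ →
    IsAdicRelationAt (FinitePlace.embedding v) y ξ Q)

omit [NumberField K] in
/-- `Q` is a **trivial relation** of degree `δ` between `y₁, …, yₙ` at `ξ`: it is the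
specialisation at `X = ξ` of a homogeneous FUNCTIONAL relation of the same degree, i.e. of some
`Q̃ ∈ K[X][Y₁,…,Yₙ]`, homogeneous of degree `δ` in `Y`, with `Q̃(X)(y₁(X), …, yₙ(X)) = 0` in
`K⟦X⟧`. (Witnesses over `K[X]`; equivalent to witnesses over `ℚ̄[X]` by linear algebra, see the
module docstring.) [cite: DawOrr2025, Definition 2.3 (3)] -/
def IsTrivialRelationAt {n : ℕ} (y : Fin n → PowerSeries K) (ξ : K)
    (Q : MvPolynomial (Fin n) K) (δ : ℕ) : Prop :=
  ∃ Qt : MvPolynomial (Fin n) K[X], Qt.IsHomogeneous δ ∧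
    MvPolynomial.aeval (fun j => y j) Qt = 0 ∧
    MvPolynomial.map (Polynomial.evalRingHom ξ) Qt = Q

end GFunction

end NumberFieldLevel

/-! ### 4. André's Hasse principle for the values of `G`-functions (named fact) -/

open GFunction in
/-- **André's "Hasse principle" for the values of `G`-functions** (named fact; [Andre1989]
Introduction Thm. E, deduced from Ch. VII Thm. 5.2; as restated and deduced in [DawOrr2025]
Thm. 2.5; [Papas2022] Thm. 2): let `y₁, …, yₙ` be `G`-functions with coefficients in a number
field `K`. There are constants `c₁, c₂ ≥ 0`, depending only on the `yᵢ`, such that for every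
number field `L ⊇ K`, every `ξ ∈ L ∖ {0}`, every `δ > 0` and every homogeneous
`Q ∈ L[Y₁,…,Yₙ]` of degree `δ`: if `Q` is a GLOBAL relation between the evaluations at `ξ` of
`y₁, …, yₙ` (every place of `L` at which `|ξ| < min{1, radii}`) which is NOT TRIVIAL (not the
specialisation at `ξ` of a homogeneous functional relation of degree `δ`), then
`h(ξ) ≤ c₁ δ^{c₂}`, written with Mathlib's relative height as
`logHeight₁ ξ ≤ [L:ℚ] · c₁ δ^{c₂}`. In particular (Northcott) the `ξ` of bounded degree carrying
a non-trivial global relation of degree `δ` form a finite set. Users take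
`(h : andre_hassePrinciple_gValues)`.
[cite: DawOrr2025, Theorem 2.5] -/
def andre_hassePrinciple_gValues : Prop :=
  ∀ (K : Type) [Field K] [NumberField K] (n : ℕ) (y : Fin n → PowerSeries K),
    (∀ j, IsGFunction (y j)) →
    ∃ c₁ c₂ : ℝ, 0 ≤ c₁ ∧ 0 ≤ c₂ ∧
      ∀ (L : Type) [Field L] [NumberField L] [Algebra K L] (ξ : L), ξ ≠ 0 →
      ∀ δ : ℕ, 0 < δ → ∀ Q : MvPolynomial (Fin n) L, Q.IsHomogeneous δ →
        IsGlobalRelationAt (fun j => PowerSeries.map (algebraMap K L) (y j)) ξ Q →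
        ¬ IsTrivialRelationAt (fun j => PowerSeries.map (algebraMap K L) (y j)) ξ Q δ →
          Height.logHeight₁ ξ ≤ Module.finrank ℚ L * (c₁ * (δ : ℝ) ^ c₂)

/-! ### 5. Proved API: the geometric series and the constant `1` -/

/-- The formal derivative of the geometric series `∑ Xⁿ` is `∑ (n+1) Xⁿ`. [folklore] -/
theorem derivative_mk_one {R : Type*} [CommRing R] :
    PowerSeries.derivative R (PowerSeries.mk fun _ => (1 : R)) = PowerSeries.mk fun n => (n : R) + 1 := by
  ext n
  rw [PowerSeries.coeff_derivative, coeff_mk, coeff_mk, one_mul]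

/-- `(1 − X) · (∑ Xⁿ)′ − ∑ Xⁿ = 0` in `R⟦X⟧` — the linear differential equation of `1/(1 − X)`.
[folklore] -/
theorem one_sub_X_mul_derivative_mk_one_sub {R : Type*} [CommRing R] :
    ((1 : PowerSeries R) - PowerSeries.X) * PowerSeries.derivative R (PowerSeries.mk fun _ => (1 : R))
      - PowerSeries.mk (fun _ => (1 : R)) = 0 := by
  rw [derivative_mk_one, sub_eq_zero, sub_mul, one_mul]
  ext n
  rw [map_sub]
  rcases n with _ | n
  · rw [coeff_zero_X_mul, coeff_mk, coeff_mk]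
    simp
  · rw [coeff_succ_X_mul, coeff_mk, coeff_mk, coeff_mk]
    push_cast
    ring

section GeomProofs

variable {K : Type*} [Field K]

/-- The ODE witness `P = (−1, 1 − X)` of the geometric series over any commutative ring, mapped
from `ℤ[X]` (so that its coefficients are visibly algebraic). [folklore] -/
private def geomP (R : Type*) [CommRing R] : Fin 2 → Polynomial R :=
  fun j => Polynomial.map (Int.castRingHom R) (![-1, 1 - Polynomial.X] j)

omit [Field K] in
/-- `geomP ≠ 0` (its first entry is `−1`). [folklore] -/
private theorem geomP_ne_zero (R : Type*) [CommRing R] [Nontrivial R] : geomP R ≠ 0 := by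
  intro h
  have := congr_fun h 0
  simp [geomP] at this

omit [Field K] in
/-- `geomP` annihilates the geometric series: `−y + (1 − X) y′ = 0`. [folklore] -/
private theorem geomP_ode (R : Type*) [CommRing R] :
    ∑ j : Fin 2, (geomP R j : PowerSeries R) *
      (⇑(PowerSeries.derivative R))^[j] (PowerSeries.mk fun _ => (1 : R)) = 0 := by
  have h := one_sub_X_mul_derivative_mk_one_sub (R := R)
  rw [Fin.sum_univ_two]
  simp only [geomP, Fin.isValue, Matrix.cons_val_zero, Matrix.cons_val_one,
    Matrix.cons_val_fin_one, Polynomial.map_neg, Polynomial.map_one, Polynomial.map_sub,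
    Polynomial.map_X, Fin.val_zero, Fin.val_one, Function.iterate_zero, id_eq,
    Function.iterate_one, Polynomial.coe_neg, Polynomial.coe_one, Polynomial.coe_sub,
    Polynomial.coe_X]
  rw [← h]
  ring

/-- **The geometric series `∑ zⁿ = 1/(1 − z)` is a `G`-series** (Siegel: "zu ihnen gehört
trivialerweise die geometrische Reihe"): `aₙ = 1` is algebraic with conjugates of absolute value
`1 ≤ 1^{n+1}`, denominators `Dₙ = 1`, and `(1 − z)y′ − y = 0`. PROVED.
[cite: Rivoal2024, Définition 5.22 and p. 242] -/
theorem isGSeries_one : IsGSeries fun _ => 1 := by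
  refine ⟨fun _ => isAlgebraic_one, ?_, ?_, ?_⟩
  · refine ⟨1, geomP ℂ, geomP_ne_zero ℂ, ?_, geomP_ode ℂ⟩
    intro j k
    have hint : ∀ z : ℤ, IsAlgebraic ℚ ((z : ℂ)) := fun z => by
      simpa using isAlgebraic_algebraMap (R := ℚ) (A := ℂ) (z : ℚ)
    simp only [geomP, Polynomial.coeff_map, eq_intCast]
    exact hint _
  · refine ⟨1, one_pos, fun n b hb => ?_⟩
    rw [minpoly.one ℚ ℂ, Polynomial.mem_rootSet] at hb
    have hb1 : b = 1 := by
      have := hb.2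
      simp only [map_sub, Polynomial.aeval_X, Polynomial.aeval_one] at this
      exact sub_eq_zero.mp this
    simp [hb1]
  · refine ⟨fun _ => 1, 1, one_pos, fun n => ⟨le_rfl, by simp, fun m _ => ?_⟩⟩
    simpa using isIntegral_one

/-- **The geometric series `∑ Xⁿ ∈ K⟦X⟧` is a `G`-function over any number field `K`**
(`|σ(1)| = 1`, `dₙ = 1`, `(1 − X)y′ − y = 0`). PROVED. [cite: Rivoal2024, Définition 5.22 and p. 242] -/
theorem isGFunction_mk_one : IsGFunction (PowerSeries.mk fun _ => (1 : K)) := by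
  refine ⟨⟨1, geomP K, geomP_ne_zero K, geomP_ode K⟩, ?_, ?_⟩
  · refine ⟨1, one_pos, fun σ n => ?_⟩
    simp
  · refine ⟨fun _ => 1, 1, one_pos, fun n => ⟨le_rfl, by simp, fun m _ => ?_⟩⟩
    simpa using isIntegral_one

/-- **The constant `1 ∈ K⟦X⟧` is a `G`-function** (the `y₀ = 1` used to homogenise
inhomogeneous relations `λ₀ + ∑ λⱼ yⱼ(ξ) = 0`): `y′ = 0`, `|σ(aₙ)| ≤ 1`, `dₙ = 1`. PROVED.
[cite: DawOrr2025, Definition 2.3 (G-function)] -/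
theorem isGFunction_one : IsGFunction (1 : PowerSeries K) := by
  refine ⟨⟨1, ![0, 1], ?_, ?_⟩, ?_, ?_⟩
  · intro h
    have := congr_fun h 1
    simp at this
  · rw [Fin.sum_univ_two]
    simp
  · refine ⟨1, one_pos, fun σ n => ?_⟩
    rw [PowerSeries.coeff_one]
    split_ifs <;> simp
  · refine ⟨fun _ => 1, 1, one_pos, fun n => ⟨le_rfl, by simp, fun m _ => ?_⟩⟩
    rw [PowerSeries.coeff_one]
    split_ifs
    · simpa using isIntegral_one
    · simpa using isIntegral_zero

end GeomProofs

/-! ### 6. Proved API: unfolding lemmas for the relation vocabulary -/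

namespace GFunction

variable {K : Type*} [Field K] {F : Type*} [NormedField F]

/-- Unfolding `IsAdicRelationAt`. [cite: DawOrr2025, Definition 2.3 (1)] -/
theorem isAdicRelationAt_iff (ι : K →+* F) {n : ℕ} (y : Fin n → PowerSeries K)
    (ξ : K) (Q : MvPolynomial (Fin n) K) :
    IsAdicRelationAt ι y ξ Q ↔ IsSmallAt ι y ξ ∧ adicEval ι y ξ Q = 0 := Iff.rfl

/-- The zero polynomial is an `ι`-adic relation wherever the smallness condition holds.
[folklore] -/
theorem isAdicRelationAt_zero (ι : K →+* F) {n : ℕ} (y : Fin n → PowerSeries K) (ξ : K)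
    (h : IsSmallAt ι y ξ) : IsAdicRelationAt ι y ξ (0 : MvPolynomial (Fin n) K) :=
  ⟨h, by simp [adicEval]⟩

/-- The zero polynomial is a global relation. [folklore] -/
theorem isGlobalRelationAt_zero [NumberField K] {n : ℕ} (y : Fin n → PowerSeries K) (ξ : K) :
    IsGlobalRelationAt y ξ (0 : MvPolynomial (Fin n) K) :=
  ⟨fun σ h => isAdicRelationAt_zero σ y ξ h, fun _ h => isAdicRelationAt_zero _ y ξ h⟩

/-- The zero polynomial is a trivial relation of every degree (witness `Q̃ = 0`). [folklore] -/
theorem isTrivialRelationAt_zero {n : ℕ} (y : Fin n → PowerSeries K) (ξ : K) (δ : ℕ) :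
    IsTrivialRelationAt y ξ (0 : MvPolynomial (Fin n) K) δ :=
  ⟨0, MvPolynomial.isHomogeneous_zero _ _ _, by simp, by simp⟩

/-- A point of norm `≥ 1` carries no smallness condition: `IsSmallAt` fails, so such a place
imposes nothing on a global relation. (For `K = ℚ`, `ξ = 1/b`: every finite place.) [folklore] -/
theorem not_isSmallAt_of_one_le_norm (ι : K →+* F) {n : ℕ} (y : Fin n → PowerSeries K) (ξ : K)
    (h : 1 ≤ ‖ι ξ‖) : ¬ IsSmallAt ι y ξ :=
  fun hs => (not_lt.mpr h) hs.1

end GFunction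

end Literature.NumberTheory.Transcendental
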